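import Summits.CriticalPhenomena.PercolationContinuityZ3.Theorems.PercNearOneGluingNoHeavyLowerTailSunflowerCloneCalculus
import Mathlib.Logic.Embedding.Basic
import HarnessLib

/-!
# `NoHeavyLowerTail` (crux stmt-CriticalPhenomena-4575), abstract sunflower cubic: clone calculus, part 2 — sunflower operations and the
# Bernoulli pattern weight (splitting and halving identities)

Support file (seat `prim-l12-p2` gen 6; `--supports stmt-CriticalPhenomena-4575`; between `…SunflowerCloneCalculus` and `…SunflowerCloneTransfer`).
No `sorry`, no named facts.  Memo: run/shared/lean/prim/prim-l12/prim-l12-p2/FINDING-g6-COMPOSITION-IDENTITY.md.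

* `Sunflower.comap` — the pull-back of a sunflower of up-sets (monotone map `2^E → M₃`, prim-ineq-prove-1's `Sunflower`) along a monotone map of
  configuration cubes is a sunflower; instances `del e` (lower section `S ↦ lab (S ∖ e)`), `con e` (upper section `S ↦ lab (S ∪ e)`), `dup e` (a twin
  `none` of `e` on `Option E`, `mergeOpt`), `reindex` (equivalence of ground types); `lab_comap`; the functional under them: `Mk_del`, `Mk_con`,
  `Mk_dup_sunflower`, `Mk_reindex` (invariance under reindexing, used to lift universe-`0` statements).
* `bern p B = ∏_k (p if bit k else 1 − p)` — the pattern weight of three INDEPENDENT copies of a `p`-Bernoulli coordinate; `bern_one` (`= clU`);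
  the HALVING identity `uconv (bern a) (bern b) = bern (a + b − ab)` (`bern_uconv_bern`: OR of independent twins); `uconv_cl1_cl1` (two partition twins:
  weight `1` on single-copy patterns, `2` on two-copy patterns); the SPLITTING identity
  `bern p = (1−p)³·cl0 + [p(1−p)² − p²(1−p)/2]·cl1 + [p²(1−p)/2]·uconv cl1 cl1 + p³·clU` (`bern_split`), whose coefficients are `≥ 0` for `0 ≤ p ≤ 2/3`
  (`coeff_keep_nonneg`); four-term linearity `Mk_update_lin4`.
All identities over the eight patterns are proved by exhausting `Bool × Bool × Bool` and `ring`.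
-/

namespace Summit.CriticalPhenomena.PercolationContinuityZ3.Theorems.SunflowerPartition

open Finset

section Functional

variable {E : Type*} [Fintype E] [DecidableEq E]

/-! ### Monotone pull-backs of sunflowers: delete, contract, duplicate, reindex -/

namespace Sunflower

variable {E' : Type*} [Fintype E'] [DecidableEq E'] (F : Sunflower E)

omit [Fintype E] in
/-- The pull-back of a sunflower along a monotone map of configuration cubes is a sunflower. [this work] -/
def comap (f : Finset E' → Finset E) (hf : Monotone f) : Sunflower E' where
  V i := univ.filter fun S => f S ∈ F.V i
  upper i := by
    intro S T hST hS
    simp only [coe_filter, mem_univ, true_and, Set.mem_setOf_eq] at hS ⊢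
    exact F.upper i (hf hST) hS
  inter_eq i j hij := by
    ext S
    simp only [mem_inter, mem_filter, mem_univ, true_and]
    rw [← mem_inter, ← mem_inter, F.inter_eq i j hij]

omit [Fintype E] in
/-- The labelling of a pull-back is the pulled-back labelling. [this work] -/
theorem lab_comap (f : Finset E' → Finset E) (hf : Monotone f) (S : Finset E') : (F.comap f hf).lab S = F.lab (f S) := by
  simp [Sunflower.lab, Sunflower.A, Sunflower.comap]

/-- DELETE the coordinate `e` (lower section, same ground type). [this work] -/
def del (e : E) : Sunflower E := F.comap (fun S => S.erase e) fun _ _ h => erase_subset_erase e h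

/-- CONTRACT the coordinate `e` (upper section, same ground type). [this work] -/
def con (e : E) : Sunflower E := F.comap (fun S => insert e S) fun _ _ h => insert_subset_insert e h

/-- DUPLICATE the coordinate `e` (a twin `none` on `Option E`, OR-cloning). [this work] -/
def dup (e : E) : Sunflower (Option E) := F.comap (mergeOpt e) (mergeOpt_mono e)

omit [Fintype E] in
/-- REINDEX along an equivalence of ground types. [this work] -/
def reindex (g : E' ≃ E) : Sunflower E' := F.comap (fun S => S.map g.toEmbedding) fun _ _ h => map_subset_map.2 h

/-- Labelling of `del`. [this work] -/
theorem lab_del (e : E) (S : Finset E) : (F.del e).lab S = F.lab (S.erase e) := F.lab_comap _ _ S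
/-- Labelling of `con`. [this work] -/
theorem lab_con (e : E) (S : Finset E) : (F.con e).lab S = F.lab (insert e S) := F.lab_comap _ _ S
/-- Labelling of `dup`. [this work] -/
theorem lab_dup (e : E) (S : Finset (Option E)) : (F.dup e).lab S = F.lab (mergeOpt e S) := F.lab_comap _ _ S
omit [Fintype E] in
/-- Labelling of `reindex`. [this work] -/
theorem lab_reindex (g : E' ≃ E) (S : Finset E') : (F.reindex g).lab S = F.lab (S.map g.toEmbedding) := F.lab_comap _ _ S

end Sunflower

/-! ### The functional under the sunflower operations -/

/-- `Mk` of a labelling only depends on its values (functions equal pointwise). [this work] -/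
theorem Mk_congr_lab (κ : Fin 5 → Fin 5 → Fin 5 → ℝ) {lab lab' : Finset E → Fin 5} (h : ∀ S, lab S = lab' S) (ω : E → Pat → ℝ) :
    Mk κ lab ω = Mk κ lab' ω := by
  have : lab = lab' := funext h
  rw [this]

/-- DELETE for sunflowers: `Mk κ (F.del e).lab (ω[e ↦ cl1]) = 3 · Mk κ F.lab (ω[e ↦ cl0])`. [this work] -/
theorem Mk_del (κ : Fin 5 → Fin 5 → Fin 5 → ℝ) (F : Sunflower E) (ω : E → Pat → ℝ) (e : E) :
    Mk κ (F.del e).lab (Function.update ω e cl1) = 3 * Mk κ F.lab (Function.update ω e cl0) := by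
  rw [Mk_congr_lab κ (F.lab_del e) _, Mk_erase_cl1]

/-- CONTRACT for sunflowers: `Mk κ (F.con e).lab (ω[e ↦ cl1]) = 3 · Mk κ F.lab (ω[e ↦ clU])`. [this work] -/
theorem Mk_con (κ : Fin 5 → Fin 5 → Fin 5 → ℝ) (F : Sunflower E) (ω : E → Pat → ℝ) (e : E) :
    Mk κ (F.con e).lab (Function.update ω e cl1) = 3 * Mk κ F.lab (Function.update ω e clU) := by
  rw [Mk_congr_lab κ (F.lab_con e) _, Mk_insert_cl1]

/-- DUPLICATE for sunflowers. [this work] -/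
theorem Mk_dup_sunflower (κ : Fin 5 → Fin 5 → Fin 5 → ℝ) (F : Sunflower E) (ω : E → Pat → ℝ) (e : E) (w₁ w₂ : Pat → ℝ) :
    Mk κ (F.dup e).lab (dupW ω e w₁ w₂) = Mk κ F.lab (Function.update ω e (uconv w₁ w₂)) := by
  rw [Mk_congr_lab κ (F.lab_dup e) _, Mk_dup]

/-- REINDEX: the functional is invariant under an equivalence of ground types. [this work] -/
theorem Mk_reindex {E' : Type*} [Fintype E'] [DecidableEq E'] (κ : Fin 5 → Fin 5 → Fin 5 → ℝ) (F : Sunflower E)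
    (ω : E → Pat → ℝ) (g : E' ≃ E) :
    Mk κ (F.reindex g).lab (fun x => ω (g x)) = Mk κ F.lab ω := by
  rw [Mk_congr_lab κ (F.lab_reindex g) _]
  unfold Mk
  symm
  rw [← (Equiv.arrowCongr g (Equiv.refl Pat)).sum_comp]
  refine sum_congr rfl fun β _ => ?_
  have hb : ∀ k : Fin 3, blocks (Equiv.arrowCongr g (Equiv.refl Pat) β) k = (blocks β k).map g.toEmbedding := by
    intro k
    ext x
    simp only [mem_map, mem_blocks, Equiv.arrowCongr_apply, Equiv.coe_refl, Function.comp_apply, id_eq,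
      Equiv.toEmbedding_apply]
    constructor
    · intro hx
      exact ⟨g.symm x, hx, g.apply_symm_apply x⟩
    · rintro ⟨y, hy, rfl⟩
      simpa using hy
  rw [hb, hb, hb]
  congr 1
  rw [← g.prod_comp]
  refine prod_congr rfl fun x _ => ?_
  simp [Equiv.arrowCongr_apply]



/-! ### Bernoulli pattern weights and the two identities -/

namespace Pat

/-- "Exactly two copies" (Boolean test). [this work] -/
def isDouble (B : Pat) : Bool := (B.1 && B.2.1 && !B.2.2) || (B.1 && !B.2.1 && B.2.2) || (!B.1 && B.2.1 && B.2.2)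

/-- `isSingle` on an explicit triple, as a Boolean formula. [this work] -/
theorem isSingle_mk (a b c : Bool) : isSingle (a, b, c) = ((a && !b && !c) || (!a && b && !c) || (!a && !b && c)) := by
  cases a <;> cases b <;> cases c <;> rfl

end Pat

/-- The BERNOULLI pattern weight of three independent copies: `∏_k (p if bit k else 1 − p)`. [this work] -/
def bern (p : ℝ) : Pat → ℝ := fun B => (if B.1 then p else 1 - p) * ((if B.2.1 then p else 1 - p) * (if B.2.2 then p else 1 - p))

/-- `bern 1 = clU` (a coordinate present with probability one is contracted). [this work] -/
theorem bern_one : bern 1 = clU := by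
  funext B
  rcases B with ⟨_ | _, _ | _, _ | _⟩ <;> simp [bern, clU, Pat.full]

/-- Union-convolution evaluated: an explicit 64-term sum. [this work] -/
theorem uconv_apply (w₁ w₂ : Pat → ℝ) (B : Pat) :
    uconv w₁ w₂ B = ∑ x : Pat, ∑ y : Pat, if x.union y = B then w₁ x * w₂ y else 0 := by
  unfold uconv
  rw [Fintype.sum_prod_type]

/-- **Halving identity**: twins of weights `a` and `b` OR-merge to a coordinate of weight `a + b − ab`. [this work] -/
theorem bern_uconv_bern (a b : ℝ) : uconv (bern a) (bern b) = bern (a + b - a * b) := by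
  funext B
  rw [uconv_apply]
  rcases B with ⟨_ | _, _ | _, _ | _⟩ <;>
    simp only [bern, Pat.union, Fintype.sum_prod_type, Fintype.sum_bool, Bool.or_false, Bool.or_true,
      Prod.mk.injEq, Bool.false_eq_true, Bool.true_eq_false, and_true, and_false, true_and, false_and, if_true, if_false] <;>
    ring

/-- `uconv cl1 cl1`: twins both in exactly one copy — `1` way onto a single copy, `2` ways onto two copies. [this work] -/
theorem uconv_cl1_cl1 : uconv cl1 cl1 = fun B => if B.isSingle then 1 else if B.isDouble then 2 else 0 := by
  funext B
  rw [uconv_apply]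
  rcases B with ⟨_ | _, _ | _, _ | _⟩ <;>
    simp only [cl1, Pat.isSingle_mk, Pat.isDouble, Pat.union, Fintype.sum_prod_type, Fintype.sum_bool, Bool.or_false, Bool.or_true,
      Bool.and_true, Bool.and_false, Bool.not_true, Bool.not_false, Prod.mk.injEq, Bool.false_eq_true,
      Bool.true_eq_false, and_true, and_false, true_and, false_and, if_true, if_false] <;>
    norm_num

/-- **Splitting identity** (valid for every `p`; used for `p ≤ 2/3`): the Bernoulli weight as delete + keep + duplicate + contract. [this work] -/
theorem bern_split (p : ℝ) : bern p = fun B => (1 - p) ^ 3 * cl0 B + (p * (1 - p) ^ 2 - p ^ 2 * (1 - p) / 2) * cl1 B +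
      (p ^ 2 * (1 - p) / 2) * uconv cl1 cl1 B + p ^ 3 * clU B := by
  funext B
  rw [uconv_cl1_cl1]
  rcases B with ⟨_ | _, _ | _, _ | _⟩ <;>
    simp only [bern, cl0, cl1, clU, Pat.isSingle_mk, Pat.isDouble, Pat.nil, Pat.full, Bool.and_true, Bool.and_false,
      Bool.not_true, Bool.not_false, Bool.or_false, Bool.or_true, Prod.mk.injEq, Bool.false_eq_true, Bool.true_eq_false,
      and_true, and_false, if_true, if_false] <;>
    ring

/-- Four-term linearity of `Mk` in the weight of one coordinate. [this work] -/
theorem Mk_update_lin4 (κ : Fin 5 → Fin 5 → Fin 5 → ℝ) (lab : Finset E → Fin 5) (ω : E → Pat → ℝ) (e : E)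
    (w₁ w₂ w₃ w₄ : Pat → ℝ) (c₁ c₂ c₃ c₄ : ℝ) :
    Mk κ lab (Function.update ω e fun B => c₁ * w₁ B + c₂ * w₂ B + c₃ * w₃ B + c₄ * w₄ B) =
      c₁ * Mk κ lab (Function.update ω e w₁) + c₂ * Mk κ lab (Function.update ω e w₂) +
      c₃ * Mk κ lab (Function.update ω e w₃) + c₄ * Mk κ lab (Function.update ω e w₄) := by
  rw [Mk_update_eq_sum, Mk_update_eq_sum, Mk_update_eq_sum, Mk_update_eq_sum, Mk_update_eq_sum, mul_sum, mul_sum, mul_sum, mul_sum,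
    ← sum_add_distrib, ← sum_add_distrib, ← sum_add_distrib]
  refine sum_congr rfl fun B _ => ?_
  ring

/-- The KEEP coefficient is nonnegative for `0 ≤ p ≤ 2/3`. [this work] -/
theorem coeff_keep_nonneg {p : ℝ} (h0 : 0 ≤ p) (h23 : p ≤ 2 / 3) : 0 ≤ p * (1 - p) ^ 2 - p ^ 2 * (1 - p) / 2 := by
  have h : p * (1 - p) ^ 2 - p ^ 2 * (1 - p) / 2 = p * (1 - p) * (2 - 3 * p) / 2 := by ring
  rw [h]
  refine div_nonneg (mul_nonneg (mul_nonneg h0 (by linarith)) (by linarith)) (by norm_num)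

end Functional

end Summit.CriticalPhenomena.PercolationContinuityZ3.Theorems.SunflowerPartition
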